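import Mathlib
import Literature.NumberTheory.LFunctions.KloostermanPrimePower
import HarnessLib

/-!
# Kloosterman sums against primes, the Möbius function and divisor functions to ONE prime modulus
# (Fouvry–Kowalski–Michel 2014, «Algebraic trace functions over the primes», §1.0–§1.4:
# Theorems 1.5, 1.7, 1.15, 1.16 and Remark 1.6 — the Kloosterman instance)

Topic `Literature/NumberTheory/LFunctions` (namespace `Literature.NumberTheory.LFunctions`, sub-namespace
`FKM2014`). STATEMENT LAYER (D-0014): four NAMED FACTS (`def … : Prop`, status theorem-in-print, nothing
asserted, nothing proved beyond bookkeeping), typed for the cell `landau-siegel` (rung F-S3), design families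
B-len / B-multi, registry row **E-006 E*-cross** (HOME/obj/EDREGISTRY.md; OBJECTIVE.md §3.3): the bulk × band
cross term of a profile that does not vanish at the wall `z = 1` is, after Zhang's Lemma 8.1 reflection, a
correlation of Kloosterman sums `S(1, a; p)` to the PRIME modulus `p` against coefficients of length
`≍ P t₀ ≥ p^{3/4+ε}` (pub/zhang-knife/zhang-knife-ref/FEASIBILITY.md v1.0b §0.6). The nearest printed technology
is the Fouvry–Kowalski–Michel theory of sums of TRACE WEIGHTS `K(n)` (trace functions of `ℓ`-adic sheaves on
`𝔸¹_{𝔽_p}` of bounded conductor) against primes / Möbius / divisor functions, with power savings as soon as the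
length `X` exceeds `p^{3/4+ε}` (Remark 1.6). Mathlib has no vocabulary for `ℓ`-adic sheaves, so every fact below
is stated for the ONE trace weight the cross term actually meets,

  `K(n) = Kl₂(a·n; p) = p^{−1/2} · S(1, a·n; p)`,  `a ∈ (ℤ/pℤ)ˣ`,

the normalised Kloosterman sum (the tree's `Literature.NumberTheory.LFunctions.kloostermanSum`, written inline),
uniformly in `p` and `a` — `-- TODO(general form): isotypic trace weights of bounded conductor`. The companion
file of ls-Bmulti-typer-1 (`BilinearKloostermanSumsPrimeModulus.lean`: FKM14 Thm 1.17 type II / type I,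
Cor 1.13, Kowalski–Michel–Sawin 2017 Thm 1.1/1.3) carries the general-coefficient BILINEAR statements; this
file carries the prime / Möbius / Eisenstein (divisor) / type-`I₂` statements. Nothing here is a claim about a
sum over a WINDOW of primes `p`, about exceptional characters, or about the manuscript arXiv:2211.02515.

## Why the Kloosterman instance is an instance (source, §1.2 and §5.2)

Definition 1.3 (p0003:L104–118): an isotypic trace weight mod `p` is the trace function `K(x) = ι(tr(Frob_x | 𝓕))`
of a geometrically isotypic `ℓ`-adic Fourier sheaf `𝓕` on `𝔸¹_{𝔽_p}`, pointwise pure of weight `0`; its conductor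
is `cond(𝓕) = rank(𝓕) + Σ_x (1 + Swan_x(𝓕))` over the singularities. "Exceptional" (p0004:L21–33) = proportional
to `χ(n)ψ(n)` (Kummer ⊗ Artin–Schreier, rank one). §5.2 (p0016:L113–134): "there exists a `ℚ̄_ℓ`-adic sheaf
`𝒦ℓ_m` on `ℙ¹_{𝔽_p}` (constructed by Deligne and studied by Katz in [GKM]) such that: the sheaf `𝒦ℓ_m` has rank
`m` and is lisse on `𝔾_m`, tamely ramified at `0` with a single Jordan block and wildly ramified at `∞` with Swan
conductor `1` (in particular `cond(𝒦ℓ) = m + 3`); the sheaf `𝒦ℓ_m` is geometrically irreducible …; the sheaf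
`𝒦ℓ_m` is pointwise pure of weight `0`, and for any `a ∈ 𝔽_p^×` the trace of the Frobenius at `a` equals
`ι(tr(Frob_a | 𝒦ℓ_m)) = (−1)^{m−1} Kl_m(a; p)`" (Remark 1.4, p0004:L1–2: "For the hyper-Kloosterman sums
`K(n) = Kl_m(n;p)`, the conductor is `m + 3`"). Hence for every prime `p` and every `a ∈ 𝔽_p^×` the weight
`n ↦ Kl₂(a n; p)` (pull-back of `𝒦ℓ₂` by the automorphism `x ↦ a x`, same local structure) is, up to the sign
`(−1)^{m−1} = −1` which no upper bound sees, an isotypic trace weight of conductor `5`, geometrically irreducible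
of rank `2`, hence NOT exceptional and NOT geometrically trivial — exactly the hypotheses of Theorems 1.5, 1.7,
1.15, 1.16 — with conductor INDEPENDENT of `p` and `a`. The source itself draws this instance: §1.2 "Kloosterman
sums at prime arguments", Corollary 1.13 (p0006:L18–34), is Theorem 1.5 for `K(n) = Kl₂(n q; p)` with `log`-weights.
Since every implied constant below "depends only on `η`, `cond(𝓕)` [polynomially] and the implicit constants in
(1.6)", in the instance it depends on `η` and the test-function budget alone.

Value at `n ≡ 0 (mod p)`: the facts below evaluate `K` by the defining formula of `Kl₂` at every residue, so
`K(n) = Kl₂(0; p) = −p^{−1/2}` when `p ∣ n` (p0003:L85–88: `Kl_m(n;p) = p^{−(m−1)/2} Σ_{x₁⋯x_m = n} e((x₁+⋯+x_m)/p)`;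
at `n = 0` the sum is `−(−1)^m`). Whatever value the middle extension assigns at `0`, it is of modulus `≤ 2` and
is met by at most `⌊2X/p⌋ + 1` terms of each sum, a total `≪_ε X^{1+ε} p^{−1} + 1`, which is inside every stated
right-hand side (`≥ X p^{−η}` with `η < 1/8`, `X ≥ 1`); the choice is immaterial to the facts as typed.

## What the source prints (held text `paper:arxiv-1211.6043`, TeX chunks p0003–p0008, read 2026-08-26)

É. Fouvry, E. Kowalski, Ph. Michel, *Algebraic trace functions over the primes*, Duke Math. J. **163** (2014),
no. 9, 1683–1736, doi:10.1215/00127094-2690587, arXiv:1211.6043 [FouvryKowalskiMichel2014TracePrimes].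

**Test functions (1.6)** (p0004:L37–45). "We will consider smooth test functions `V`, compactly supported in
`[1/2, 2]`, such that `x^j V^{(j)}(x) ≪ Q^j` (1.6) for some `Q ≥ 1` and for any integer `j ≥ 0`, where the
implicit constant depends on `j`."

> **Theorem 1.5 (Trace weights vs. primes)** (p0004:L48–66). Let `K` be an isotypic trace weight on `𝔽_p`
> associated to some sheaf `𝓕`, and assume that `𝓕` is not exceptional. Let `V` be a smooth function as above
> satisfying (1.6) for some parameter `Q ≥ 1`. For any `X ≥ 2`, we have
> `Σ_{q prime} K(q) V(q/X) ≪ Q X (1 + p/X)^{1/6} p^{−η}`,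
> `Σ_{q prime, q ≤ X} K(q) ≪ X (1 + p/X)^{1/12} p^{−η/2}`,
> for any `η < 1/24`. The implicit constants depend only on `η`, `cond(𝓕)` and the implicit constants in (1.6).
> Moreover, the dependency on `cond(𝓕)` is at most polynomial.

> **Remark 1.6** (p0004:L68–79). For `X = p` one gets `Σ_{q prime, q < p} K(q) ≪ p^{1−1/48+ε}`, and for general
> `X` these bounds are non-trivial as long as the conductor of `𝓕` remains bounded and the range `X` is greater
> than `p^{3/4+ε}` for some `ε > 0`.

> **Theorem 1.7 (Trace weights vs. Möbius)** (p0004:L94–109). Let `μ` denote the Möbius function. With the same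
> notations and hypotheses as in Theorem 1.5, we have for `X ≥ 2`
> `Σ_n μ(n) K(n) V(n/X) ≪ Q X (1 + p/X)^{1/6} p^{−η}`,  `Σ_{n ≤ X} μ(n) K(n) ≪ X (1 + p/X)^{1/12} p^{−η/2}`,
> for any `η < 1/24`, where the implicit constants depend only on `η`, `cond(𝓕)` and the implicit constants in
> (1.6), and the dependency on `cond(𝓕)` is at most polynomial.

§1.4 (p0007:L64–72): "`S_{V,X}(it, K) = Σ_n K(n) d_{it}(n) V(n/X)` (1.13) where `t ∈ ℝ`, and (for any `u ∈ ℂ`)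
we denote by `d_u(n) = d_{−u}(n) = Σ_{ab = n} (a/b)^u` the twisted divisor function."

> **Theorem 1.15 (Algebraic twists of Eisenstein series)** (p0007:L91–109). Let `K` be an isotypic trace weight
> associated to the `ℓ`-adic sheaf `𝓕` modulo `p`. Let `V` be a smooth function satisfying (1.6) with parameter
> `Q ≥ 1`. If `𝓕` is not geometrically trivial, then for any `X ≥ 1`, we have
> `S_{V,X}(it, K) = Σ_n K(n) d_{it}(n) V(n/X) ≪ (1 + |t|)^A Q X (1 + p/X)^{1/2} p^{−η}`
> for any `η < 1/8` and some `A ≥ 1` possibly depending on `η`. The implicit constant depends only on `η`, on the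
> implicit constants in (1.6), and polynomially on the conductor of `𝓕`.

> **Theorem 1.16 (Type `I₂` sums of trace weights)** (p0007:L111–136). Let `K` be an isotypic trace weight
> associated to the `ℓ`-adic sheaf `𝓕` modulo `p`. Let `M, N, X ≥ 1` be parameters with `X/4 ≤ MN ≤ X`. Let `U`,
> `V`, `W` be smooth functions satisfying condition (1.6) with respective parameters `Q_U, Q_V` and `Q_W`, all
> `≥ 1`. We then have
> `Σ_{m,n} K(mn) (m/n)^{it} U(m/M) V(n/N) W(mn/X) ≪ (1 + |t|)^A (Q_U + Q_V)^B Q_W X (1 + p/X)^{1/2} p^{−η}`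
> for `t ∈ ℝ` and for any `η < 1/8` and some constants `A, B ≥ 1` depending on `η` only. The implicit constant
> depends only on `η`, on the implicit constants in (1.6), and polynomially on the conductor of `𝓕`.
> (Remark (2), p0007:L138–141: "Here we obtain non trivial estimates for `MN ≫ p^{3/4+ε}` in particular when
> `M, N ≫ p^{3/8+ε}`.")

## Lean rendering / design choices

* `Kl₂(a; p) := kloostermanSum p 1 a / √p` (the tree's `S(a₁, b; q) = Σ_{x ∈ (ℤ/qℤ)ˣ} e((a₁x + b x⁻¹)/q)`; with
  `x y = a`, `Σ_{xy = a} e((x + y)/p) = S(1, a; p)`), written inline in `FKM2014.kl2`; the weight on integers is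
  `FKM2014.klWeight p a n = Kl₂(a·n; p)`.
* Test functions: REAL-valued `V : ℝ → ℝ`, `ContDiff ℝ ∞ V`, `tsupport V ⊆ [1/2, 2]`, and a derivative BUDGET
  `C : ℕ → ℝ` fixed first: `|x^j V^{(j)}(x)| ≤ C j · Q^j` for all `j, x` (`iteratedDeriv`) — the "implicit
  constant depends on `j`" of (1.6); the `O`-constant `K` may then depend on `η` and `C` (and, in Theorem 1.16,
  ONE budget serves `U, V, W` — equivalent to three budgets by taking their maximum).
* Every sum is finite: `V(n/X) = 0` unless `X/2 ≤ n ≤ 2X`, so the smoothed sums are written over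
  `1 ≤ n ≤ ⌊2X⌋` (exact, not a truncation); the sharp sums over `n ≤ ⌊X⌋`; in Theorem 1.16 over `m ≤ ⌊2M⌋`,
  `n ≤ ⌊2N⌋`.
* `(a/b)^{it}`, `(m/n)^{it}` for positive rationals: principal complex power of a positive real base,
  `((a/b : ℝ) : ℂ) ^ (t·I)`; `d_{it}(n) = Σ_{d ∣ n} (d/(n/d))^{it}` over `Nat.divisors`.
* Quantifier order as printed: `η` (and the budget) first, then the existential constants (`A`, `B`, `K`), then
  `p`, `a`, `Q`, the test functions, `X` (`≥ 2` in 1.5/1.7, `≥ 1` in 1.15/1.16), `t`. "`η < 1/24`" is typed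
  literally (no positivity needed: smaller `η` only weakens the bound). Each theorem's smoothed and sharp forms are
  separate conjuncts of ONE fact, both under the binders they use.
* PROVED here (bookkeeping only): `kl2_eq` (unfolding), `klWeight_def`, `twistedDivisor_zero` (`d_0 = d`, the
  divisor-function case of Theorem 1.15), `fouvryKowalskiMichel2014_theorem15.at_conductor` (Remark 1.6 at
  `X = p`), and the Remark-1.6 threshold arithmetic
  `FKM2014.remark16_threshold` — the sharp prime-sum bound `X(1+p/X)^{1/12}p^{−η/2}` beats the trivial bound `X`
  in the exponent exactly when `log X / log p > 1 − 6η`, which at the supremum `η → 1/24⁻` is the printed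
  `X ≥ p^{3/4+ε}`.
No instances, no notation; imports `KloostermanPrimePower` (for `kloostermanSum`) and Mathlib only.

## References

* [FouvryKowalskiMichel2014TracePrimes] §1 Def. 1.3, Rem. 1.4, (1.6), Thm 1.5, Rem. 1.6, Thm 1.7; §1.4 (1.13),
  Thm 1.15, Thm 1.16 + Remark; §1.2 Cor. 1.13 (the printed Kloosterman instance, typed in the companion file);
  §5.2 (the Kloosterman sheaf `𝒦ℓ_m`: rank, ramification, conductor `m+3`, irreducibility, purity, trace).
* N. M. Katz, *Gauss sums, Kloosterman sums, and monodromy groups* (the source's [GKM]) — cited through the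
  source's §5.2 only.
* Tree: `Literature.NumberTheory.LFunctions.kloostermanSum` (KloostermanPrimePower.lean), proved Weil bound
  `weil_kloosterman_bound_holds` (the trivial-range companion `|S(m,n;p)| ≤ 2√p`).
-/

noncomputable section

open Finset
open scoped ContDiff

namespace Literature.NumberTheory.LFunctions

namespace FKM2014

/-- The normalised Kloosterman sum `Kl₂(a; p) = p^{−1/2} Σ_{xy = a} e((x+y)/p) = S(1, a; p)/√p`
(source p0003:L85–88 with `m = 2`), over the tree's `kloostermanSum`.
[cite: FouvryKowalskiMichel2014TracePrimes, §1 (definition of `Kl_m`)] -/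
def kl2 (p : ℕ) [NeZero p] (a : ZMod p) : ℂ :=
  kloostermanSum p 1 a / ((Real.sqrt p : ℝ) : ℂ)

/-- Unfolding of `kl2`. [cite: FouvryKowalskiMichel2014TracePrimes, §1 (definition of `Kl_m`)] -/
theorem kl2_eq (p : ℕ) [NeZero p] (a : ZMod p) :
    kl2 p a = kloostermanSum p 1 a / ((Real.sqrt p : ℝ) : ℂ) := rfl

/-- The Kloosterman trace weight on the integers, `K(n) = Kl₂(a·n; p)` (`a ∈ 𝔽_p^×` fixed; evaluated by the
defining formula at every residue, in particular `K(n) = Kl₂(0;p) = −p^{−1/2}` when `p ∣ n` — see the module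
docstring, "Value at `n ≡ 0`"). [cite: FouvryKowalskiMichel2014TracePrimes, §1.2 and §5.2] -/
def klWeight (p : ℕ) [NeZero p] (a : ZMod p) (n : ℕ) : ℂ := kl2 p (a * (n : ZMod p))

/-- Unfolding of `klWeight`. [cite: FouvryKowalskiMichel2014TracePrimes, §1.2] -/
theorem klWeight_def (p : ℕ) [NeZero p] (a : ZMod p) (n : ℕ) :
    klWeight p a n = kloostermanSum p 1 (a * (n : ZMod p)) / ((Real.sqrt p : ℝ) : ℂ) := rfl

/-- **Condition (1.6)** with an explicit derivative budget `C`: `V` is smooth, supported in `[1/2, 2]`, and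
`|x^j V^{(j)}(x)| ≤ C_j · Q^j` for every `j ≥ 0` and every `x` ("`x^j V^{(j)}(x) ≪ Q^j` … where the implicit
constant depends on `j`"). [cite: FouvryKowalskiMichel2014TracePrimes, §1 (1.6) p0004:L37–45] -/
def TestFunction (C : ℕ → ℝ) (Q : ℝ) (V : ℝ → ℝ) : Prop :=
  ContDiff ℝ ∞ V ∧ tsupport V ⊆ Set.Icc (1 / 2 : ℝ) 2 ∧
    ∀ (j : ℕ) (x : ℝ), |x ^ j * iteratedDeriv j V x| ≤ C j * Q ^ j

/-- The smoothed prime sum `Σ_{q prime} K(q) V(q/X)` with `K(n) = Kl₂(a n; p)`; since `V(q/X) = 0` for `q > 2X`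
it is the finite sum over the primes `q ≤ ⌊2X⌋`. [cite: FouvryKowalskiMichel2014TracePrimes, Thm 1.5] -/
def primeSumSmooth (p : ℕ) [NeZero p] (a : ZMod p) (V : ℝ → ℝ) (X : ℝ) : ℂ :=
  ∑ q ∈ (Finset.Icc 1 ⌊2 * X⌋₊).filter Nat.Prime, klWeight p a q * ((V ((q : ℝ) / X) : ℝ) : ℂ)

/-- The sharp prime sum `Σ_{q prime, q ≤ X} K(q)` with `K(n) = Kl₂(a n; p)`.
[cite: FouvryKowalskiMichel2014TracePrimes, Thm 1.5] -/
def primeSumSharp (p : ℕ) [NeZero p] (a : ZMod p) (X : ℝ) : ℂ :=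
  ∑ q ∈ (Finset.Icc 1 ⌊X⌋₊).filter Nat.Prime, klWeight p a q

/-- The smoothed Möbius sum `Σ_n μ(n) K(n) V(n/X)` (finite: `n ≤ ⌊2X⌋`).
[cite: FouvryKowalskiMichel2014TracePrimes, Thm 1.7] -/
def moebiusSumSmooth (p : ℕ) [NeZero p] (a : ZMod p) (V : ℝ → ℝ) (X : ℝ) : ℂ :=
  ∑ n ∈ Finset.Icc 1 ⌊2 * X⌋₊,
    ((ArithmeticFunction.moebius n : ℤ) : ℂ) * klWeight p a n * ((V ((n : ℝ) / X) : ℝ) : ℂ)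

/-- The sharp Möbius sum `Σ_{n ≤ X} μ(n) K(n)`. [cite: FouvryKowalskiMichel2014TracePrimes, Thm 1.7] -/
def moebiusSumSharp (p : ℕ) [NeZero p] (a : ZMod p) (X : ℝ) : ℂ :=
  ∑ n ∈ Finset.Icc 1 ⌊X⌋₊, ((ArithmeticFunction.moebius n : ℤ) : ℂ) * klWeight p a n

/-- The twisted divisor function `d_{it}(n) = Σ_{ab = n} (a/b)^{it}` (source (1.13)ff., p0007:L68–72), the
Fourier coefficient of the unitary Eisenstein series `E(z, 1/2 + it)`; `(a/b)^{it}` = principal complex power of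
the positive real `a/b`. [cite: FouvryKowalskiMichel2014TracePrimes, §1.4 p0007:L68–72] -/
def twistedDivisor (t : ℝ) (n : ℕ) : ℂ :=
  ∑ d ∈ n.divisors, (((d : ℝ) / ((n / d : ℕ) : ℝ) : ℝ) : ℂ) ^ ((t : ℂ) * Complex.I)

/-- At `t = 0` the twisted divisor function is the divisor function, `d_0(n) = d(n) = #{d ∣ n}` — the case of
Theorem 1.15 that meets divisor-type coefficients. [cite: FouvryKowalskiMichel2014TracePrimes, §1.4 p0007:L68–72] -/
theorem twistedDivisor_zero (n : ℕ) : twistedDivisor 0 n = (n.divisors.card : ℂ) := by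
  simp [twistedDivisor]

/-- `S_{V,X}(it, K) = Σ_n K(n) d_{it}(n) V(n/X)` (source (1.13)) with `K(n) = Kl₂(a n; p)` (finite: `n ≤ ⌊2X⌋`).
[cite: FouvryKowalskiMichel2014TracePrimes, §1.4 (1.13), Thm 1.15] -/
def eisensteinTwistSum (p : ℕ) [NeZero p] (a : ZMod p) (V : ℝ → ℝ) (X : ℝ) (t : ℝ) : ℂ :=
  ∑ n ∈ Finset.Icc 1 ⌊2 * X⌋₊,
    klWeight p a n * twistedDivisor t n * ((V ((n : ℝ) / X) : ℝ) : ℂ)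

/-- The type-`I₂` sum `Σ_{m,n} K(mn) (m/n)^{it} U(m/M) V(n/N) W(mn/X)` with `K(n) = Kl₂(a n; p)` (finite:
`m ≤ ⌊2M⌋`, `n ≤ ⌊2N⌋` by the supports of `U`, `V`). [cite: FouvryKowalskiMichel2014TracePrimes, Thm 1.16] -/
def typeI2Sum (p : ℕ) [NeZero p] (a : ZMod p) (U V W : ℝ → ℝ) (M N X : ℝ) (t : ℝ) : ℂ :=
  ∑ m ∈ Finset.Icc 1 ⌊2 * M⌋₊, ∑ n ∈ Finset.Icc 1 ⌊2 * N⌋₊,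
    klWeight p a (m * n) * (((m : ℝ) / (n : ℝ) : ℝ) : ℂ) ^ ((t : ℂ) * Complex.I) *
      ((U ((m : ℝ) / M) : ℝ) : ℂ) * ((V ((n : ℝ) / N) : ℝ) : ℂ) * ((W ((m : ℝ) * (n : ℝ) / X) : ℝ) : ℂ)

/-- **Remark 1.6, the threshold arithmetic** (bookkeeping, proved): writing `X = p^x`, the sharp bound of
Theorem 1.5 has exponent `x + (1 − x)/12 − η/2` (for `X ≤ p`), which is below the trivial exponent `x` iff
`x > 1 − 6η`; as `η → 1/24⁻` this is the printed range "`X ≥ p^{3/4+ε}`".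
[cite: FouvryKowalskiMichel2014TracePrimes, Rem. 1.6 p0004:L68–79] -/
theorem remark16_threshold (x η : ℝ) :
    x + (1 - x) / 12 - η / 2 < x ↔ 1 - 6 * η < x := by
  constructor <;> intro h <;> linarith

/-- At the supremum `η = 1/24` the threshold `1 − 6η` is exactly `3/4`.
[cite: FouvryKowalskiMichel2014TracePrimes, Rem. 1.6] -/
theorem remark16_threshold_value : (1 : ℝ) - 6 * (1 / 24) = 3 / 4 := by norm_num

end FKM2014

open FKM2014

/-- **Fouvry–Kowalski–Michel 2014, Theorem 1.5 (trace weights vs. primes) — Kloosterman instance.**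
For the trace weight `K(n) = Kl₂(a n; p)` (`p` prime, `a ∈ 𝔽_p^×`; conductor `5`, not exceptional — module
docstring): for every `η < 1/24` and every derivative budget `C` there is a constant `K₀` such that for every
`p`, `a`, every `Q ≥ 1`, every test function `V` satisfying (1.6) with parameter `Q`, and every `X ≥ 2`,
`|Σ_{q prime} K(q) V(q/X)| ≤ K₀ · Q X (1 + p/X)^{1/6} p^{−η}` and `|Σ_{q prime, q ≤ X} K(q)| ≤ K₀ · X (1 + p/X)^{1/12} p^{−η/2}`.
NAMED FACT (theorem in print), not proved here. -- TODO(general form): isotypic non-exceptional trace weights of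
bounded conductor, constants polynomial in the conductor.
[cite: FouvryKowalskiMichel2014TracePrimes, Thm 1.5 p0004:L48–66] -/
def fouvryKowalskiMichel2014_theorem15 : Prop :=
  ∀ η : ℝ, η < 1 / 24 → ∀ C : ℕ → ℝ, ∃ K₀ : ℝ, 0 < K₀ ∧
    ∀ (p : ℕ) [NeZero p], p.Prime → ∀ a : ZMod p, a ≠ 0 →
      (∀ (Q : ℝ), 1 ≤ Q → ∀ V : ℝ → ℝ, TestFunction C Q V → ∀ X : ℝ, 2 ≤ X →
          ‖primeSumSmooth p a V X‖ ≤
            K₀ * Q * X * (1 + (p : ℝ) / X) ^ ((1 : ℝ) / 6) * (p : ℝ) ^ (-η)) ∧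
      (∀ X : ℝ, 2 ≤ X →
          ‖primeSumSharp p a X‖ ≤ K₀ * X * (1 + (p : ℝ) / X) ^ ((1 : ℝ) / 12) * (p : ℝ) ^ (-η / 2))

/-- **Fouvry–Kowalski–Michel 2014, Theorem 1.7 (trace weights vs. Möbius) — Kloosterman instance.**
Same binders as Theorem 1.5: `|Σ_n μ(n) K(n) V(n/X)| ≤ K₀ · Q X (1 + p/X)^{1/6} p^{−η}` and
`|Σ_{n ≤ X} μ(n) K(n)| ≤ K₀ · X (1 + p/X)^{1/12} p^{−η/2}` for `X ≥ 2`, any `η < 1/24`, `K(n) = Kl₂(a n; p)`.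
NAMED FACT (theorem in print), not proved here. -- TODO(general form): as for Theorem 1.5.
[cite: FouvryKowalskiMichel2014TracePrimes, Thm 1.7 p0004:L94–109] -/
def fouvryKowalskiMichel2014_theorem17 : Prop :=
  ∀ η : ℝ, η < 1 / 24 → ∀ C : ℕ → ℝ, ∃ K₀ : ℝ, 0 < K₀ ∧
    ∀ (p : ℕ) [NeZero p], p.Prime → ∀ a : ZMod p, a ≠ 0 →
      (∀ (Q : ℝ), 1 ≤ Q → ∀ V : ℝ → ℝ, TestFunction C Q V → ∀ X : ℝ, 2 ≤ X →
          ‖moebiusSumSmooth p a V X‖ ≤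
            K₀ * Q * X * (1 + (p : ℝ) / X) ^ ((1 : ℝ) / 6) * (p : ℝ) ^ (-η)) ∧
      (∀ X : ℝ, 2 ≤ X →
          ‖moebiusSumSharp p a X‖ ≤ K₀ * X * (1 + (p : ℝ) / X) ^ ((1 : ℝ) / 12) * (p : ℝ) ^ (-η / 2))

/-- **Fouvry–Kowalski–Michel 2014, Theorem 1.15 (algebraic twists of Eisenstein series) — Kloosterman
instance.** For `K(n) = Kl₂(a n; p)` (not geometrically trivial): for every `η < 1/8` there is `A ≥ 1` such that
for every budget `C` there is `K₀` with
`|Σ_n K(n) d_{it}(n) V(n/X)| ≤ K₀ · (1 + |t|)^A · Q X (1 + p/X)^{1/2} p^{−η}`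
for every `p`, `a`, `Q ≥ 1`, `V` satisfying (1.6) with parameter `Q`, `X ≥ 1` and `t ∈ ℝ`.
NAMED FACT (theorem in print), not proved here. -- TODO(general form): isotypic, geometrically non-trivial trace
weights, constant polynomial in the conductor.
[cite: FouvryKowalskiMichel2014TracePrimes, Thm 1.15 p0007:L91–109] -/
def fouvryKowalskiMichel2014_theorem115 : Prop :=
  ∀ η : ℝ, η < 1 / 8 → ∃ A : ℝ, 1 ≤ A ∧ ∀ C : ℕ → ℝ, ∃ K₀ : ℝ, 0 < K₀ ∧
    ∀ (p : ℕ) [NeZero p], p.Prime → ∀ a : ZMod p, a ≠ 0 →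
      ∀ (Q : ℝ), 1 ≤ Q → ∀ V : ℝ → ℝ, TestFunction C Q V → ∀ X : ℝ, 1 ≤ X → ∀ t : ℝ,
        ‖eisensteinTwistSum p a V X t‖ ≤
          K₀ * (1 + |t|) ^ A * Q * X * (1 + (p : ℝ) / X) ^ ((1 : ℝ) / 2) * (p : ℝ) ^ (-η)

/-- **Fouvry–Kowalski–Michel 2014, Theorem 1.16 (type `I₂` sums of trace weights) — Kloosterman instance.**
For `K(n) = Kl₂(a n; p)`: for every `η < 1/8` there are `A, B ≥ 1` such that for every budget `C` there is
`K₀` with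
`|Σ_{m,n} K(mn) (m/n)^{it} U(m/M) V(n/N) W(mn/X)| ≤ K₀ · (1 + |t|)^A (Q_U + Q_V)^B Q_W X (1 + p/X)^{1/2} p^{−η}`
for every `p`, `a`, all `M, N, X ≥ 1` with `X/4 ≤ MN ≤ X`, all `Q_U, Q_V, Q_W ≥ 1`, all test functions
`U, V, W` satisfying (1.6) with those parameters (one budget `C` for the three — equivalent to three budgets by
taking the maximum), and every `t ∈ ℝ`. NAMED FACT (theorem in print), not proved here.
-- TODO(general form): isotypic trace weights, constant polynomial in the conductor.
[cite: FouvryKowalskiMichel2014TracePrimes, Thm 1.16 p0007:L111–136] -/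
def fouvryKowalskiMichel2014_theorem116 : Prop :=
  ∀ η : ℝ, η < 1 / 8 → ∃ A : ℝ, 1 ≤ A ∧ ∃ B : ℝ, 1 ≤ B ∧ ∀ C : ℕ → ℝ, ∃ K₀ : ℝ, 0 < K₀ ∧
    ∀ (p : ℕ) [NeZero p], p.Prime → ∀ a : ZMod p, a ≠ 0 →
      ∀ (M N X : ℝ), 1 ≤ M → 1 ≤ N → 1 ≤ X → X / 4 ≤ M * N → M * N ≤ X →
        ∀ (QU QV QW : ℝ), 1 ≤ QU → 1 ≤ QV → 1 ≤ QW →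
          ∀ (U V W : ℝ → ℝ), TestFunction C QU U → TestFunction C QV V → TestFunction C QW W →
            ∀ t : ℝ,
              ‖typeI2Sum p a U V W M N X t‖ ≤
                K₀ * (1 + |t|) ^ A * (QU + QV) ^ B * QW * X * (1 + (p : ℝ) / X) ^ ((1 : ℝ) / 2) *
                  (p : ℝ) ^ (-η)

/-! ### Bookkeeping (proved): what the facts give at the two ends of the range -/

/-- Remark 1.6 at `X = p`: Theorem 1.5's sharp bound reads `K₀ · p · 2^{1/12} · p^{−η/2}`, a saving of
`p^{−η/2}`, any `η < 1/24` — the printed "`p^{1−1/48+ε}`".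
[cite: FouvryKowalskiMichel2014TracePrimes, Rem. 1.6 p0004:L68–72] -/
theorem fouvryKowalskiMichel2014_theorem15.at_conductor (h : fouvryKowalskiMichel2014_theorem15)
    {η : ℝ} (hη : η < 1 / 24) (C : ℕ → ℝ) :
    ∃ K₀ : ℝ, 0 < K₀ ∧ ∀ (p : ℕ) [NeZero p], p.Prime → 2 ≤ (p : ℝ) → ∀ a : ZMod p, a ≠ 0 →
      ‖primeSumSharp p a p‖ ≤
        K₀ * (p : ℝ) * (1 + (p : ℝ) / (p : ℝ)) ^ ((1 : ℝ) / 12) * (p : ℝ) ^ (-η / 2) := by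
  obtain ⟨K₀, hK₀, hall⟩ := h η hη C
  refine ⟨K₀, hK₀, fun p _ hp hp2 a ha => ?_⟩
  exact (hall p hp a ha).2 (p : ℝ) hp2

end Literature.NumberTheory.LFunctions

end
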